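import Mathlib
import Literature.Geometry.Lorentzian.ReggeWheelerChannels
import Literature.Geometry.Lorentzian.ReggeWheelerTortoise
import Literature.Geometry.Lorentzian.ReggeWheelerHorizonMass
import Literature.Analysis.PDE.Wave1DNearWindowedChannelVariable
import Summits.FinalStateConjecture.FinalStateConjecture.Theorems.PhotonSphereChannelsChannelsResolveTameDevelopmentsRPotentialRepulsion

/-!
# Crux `WindowedShellChannels` (W, item stmt-FinalStateConjecture-14085) — the near half from the
# SHOULDER of the barrier: `ρ ≥ 9M`, POSITIVE aperture `M/3 + 2M log(3/2) ≈ 1.14M`, constant `1/2`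

Support file (does not close the item; registered stub `stub_nearShoulder`, `--supports`).

The two earlier near-half files (`…NearThickShell`, `…NearThickShellSharp`) place the window top deep
in the exponential region (`x ≤ x_c − 5M`) where the Regge–Wheeler potentials grow at the constant
rate `V′ ≥ V/(4M)`. Here the VARIABLE-RATE abstract inequality
`Literature.Analysis.PDE.wave1D_nearWindowedChannel_variable` is fed with the `(s, ℓ)`-uniform,
non-increasing rate

  `k(x) = max(0, (8M − 3r(x)) / (2r(x)²))`,   `V′ ≥ 2kV`   (all `s ≤ 2 ≤ …`, `ℓ ≥ s`; indeed
  `V′ − 2kV = ℓ(ℓ+1)(r − 2M)²/r⁵ ≥ 0` wherever `r ≤ 8M/3`),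

which stays positive up to the shoulder `r = 8M/3` of the barrier (tortoise position
`x_c − M/3 − 2M log(3/2)`). Its integral is explicit, `∫ k dx = [−2 log r + ½ log(r − 2M)]`, so for a
shell edge `x_e = x_c − ρ`, `ρ ≥ 9M` (`r_e − 2M ≤ Me^{−4}`), `∫_{x_e}^{x_w} k ≥ log 3`, `θ ≤ 1/3` and the
abstract constant `(1 − 2θ)/(1 − θ) ≥ 1/2`:

* `stub_nearShoulder` — for `M > 0`, `ρ ≥ 9M`, every tortoise radius function, `s ≤ 2`, `s ≤ ℓ` and
  every global `C²` Regge–Wheeler solution with Cauchy data supported in `(−∞, x_c − ρ)`: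
  `(1/2)·E_total ≤ ch⁺(a) + ch⁻(a)` with the POSITIVE aperture `a = M/3 + 2M log(3/2)` — the near
  windows are the cones from the points `x_c ± a` INSIDE the photon shell (no lag below the centre is
  needed for near data once `ρ ≥ 9M`), uniformly in `(s, ℓ)`, infinite energy allowed.
-/

set_option linter.dupNamespace false

namespace Summit.FinalStateConjecture.FinalStateConjecture.Theorems

open MeasureTheory Set Filter Topology
open Literature.Geometry.Lorentzian Literature.Geometry.Lorentzian.ReggeWheeler Literature.Analysis.PDE

noncomputable section

namespace WindowedShellChannelsNear

variable {M : ℝ} {r : ℝ → ℝ} {xc : ℝ}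

/-! ### The shoulder rate `k = max(0, (8M − 3r)/(2r²))` along the tortoise line -/

/-- The shoulder rate is continuous. [folklore] -/
theorem continuous_shoulderRate (hr : IsTortoiseRadius M r xc) :
    Continuous fun x => max 0 ((8 * M - 3 * r x) / (2 * r x ^ 2)) := by
  have hrc := hr.continuous
  have hr0 : ∀ x, 2 * r x ^ 2 ≠ 0 := fun x => by have := hr.pos x; positivity
  exact continuous_const.max ((continuous_const.sub (continuous_const.mul hrc)).div
    (continuous_const.mul (hrc.pow 2)) hr0)

/-- The shoulder rate is non-increasing along the tortoise line (`(8M − 3ρ)/(2ρ²)` decreases on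
`(0, 16M/3]` and is negative beyond `8M/3`). [folklore] -/
theorem antitone_shoulderRate (hr : IsTortoiseRadius M r xc) :
    Antitone fun x => max 0 ((8 * M - 3 * r x) / (2 * r x ^ 2)) := by
  intro x y hxy
  have hM := hr.mass_pos
  have hax : 2 * M < r x := hr.two_mul_lt x
  have hay : 2 * M < r y := hr.two_mul_lt y
  have hrxy : r x ≤ r y := hr.strictMono.monotone hxy
  have hx0 : 0 < r x := by linarith
  have hy0 : 0 < r y := by linarith
  show max 0 ((8 * M - 3 * r y) / (2 * r y ^ 2)) ≤ max 0 ((8 * M - 3 * r x) / (2 * r x ^ 2))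
  rcases le_or_gt (r y) (16 * M / 3) with hy | hy
  · refine max_le_max le_rfl ?_
    rw [div_le_div_iff₀ (by positivity) (by positivity)]
    have h1 : 0 ≤ r y - r x := by linarith
    nlinarith [mul_nonneg h1 (mul_nonneg hx0.le (by linarith : (0 : ℝ) ≤ r y)),
      mul_nonneg h1 hx0.le, mul_le_mul_of_nonneg_left hy hx0.le,
      mul_le_mul_of_nonneg_left hrxy hx0.le]
  · have hneg : (8 * M - 3 * r y) / (2 * r y ^ 2) ≤ 0 :=
      div_nonpos_of_nonpos_of_nonneg (by linarith) (by positivity)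
    rw [max_eq_left hneg]
    exact le_max_left _ _

/-- **The shoulder growth condition**, uniformly in the spin and the angular number (any `s, ℓ`): for
`r(x) ≤ 8M/3`, `2k(x)V(x) ≤ V′(x)` with `k = (8M − 3r)/(2r²)` — indeed
`V′ − ((8M − 3r)/r²)V = ℓ(ℓ+1)(r − 2M)²/r⁵ ≥ 0`. [folklore] -/
theorem shoulderRate_mono (hr : IsTortoiseRadius M r xc) (s ℓ : ℕ) {x : ℝ}
    (hx : r x ≤ 8 * M / 3) :
    2 * max 0 ((8 * M - 3 * r x) / (2 * r x ^ 2)) * linePotential M s ℓ r x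
      ≤ deriv (linePotential M s ℓ r) x := by
  have hM := hr.mass_pos
  have hM0 : M ≠ 0 := hM.ne'
  rw [(RW.hasDerivAt_linePotential hr s ℓ x).deriv, linePotential_apply]
  unfold rwPotential
  set ρ : ℝ := r x with hρdef
  have h2 : 2 * M < ρ := hr.two_mul_lt x
  have hρpos : 0 < ρ := by linarith
  have hρ0 : ρ ≠ 0 := hρpos.ne'
  have hg0 : 0 ≤ (8 * M - 3 * ρ) / (2 * ρ ^ 2) := div_nonneg (by linarith) (by positivity)
  rw [max_eq_right hg0]
  set L : ℝ := (ℓ : ℝ) * ((ℓ : ℝ) + 1) with hL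
  set c : ℝ := (1 - (s : ℝ) ^ 2) * (2 * M) with hc
  have hL0 : 0 ≤ L := by simp only [hL]; positivity
  have key : (2 * M / ρ ^ 2 * (L / ρ ^ 2 + c / ρ ^ 3)
        + (1 - 2 * M / ρ) * (-(2 * L) / ρ ^ 3 - 3 * c / ρ ^ 4)) * (1 - 2 * M / ρ)
      - 2 * ((8 * M - 3 * ρ) / (2 * ρ ^ 2)) * ((1 - 2 * M / ρ) * (L / ρ ^ 2 + c / ρ ^ 3))
      = L * (ρ - 2 * M) ^ 2 / ρ ^ 5 := by
    field_simp
    ring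
  have hnn : 0 ≤ L * (ρ - 2 * M) ^ 2 / ρ ^ 5 := by positivity
  have hfin : 2 * ((8 * M - 3 * ρ) / (2 * ρ ^ 2)) * ((1 - 2 * M / ρ) * (L / ρ ^ 2 + c / ρ ^ 3))
      ≤ (2 * M / ρ ^ 2 * (L / ρ ^ 2 + c / ρ ^ 3)
        + (1 - 2 * M / ρ) * (-(2 * L) / ρ ^ 3 - 3 * c / ρ ^ 4)) * (1 - 2 * M / ρ) := by
    rw [← key] at hnn
    linarith
  simpa only [hL, hc] using hfin

/-- The primitive of the shoulder rate: `d/dx [−2 log r + ½ log(r − 2M)] = (8M − 3r)/(2r²)` along a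
tortoise radius function (`r′ = 1 − 2M/r`). [folklore] -/
theorem hasDerivAt_shoulderPrimitive (hr : IsTortoiseRadius M r xc) (x : ℝ) :
    HasDerivAt (fun y => -2 * Real.log (r y) + 1 / 2 * Real.log (r y - 2 * M))
      ((8 * M - 3 * r x) / (2 * r x ^ 2)) x := by
  have hpos := hr.pos x
  have hsub := hr.sub_pos x
  have h1 : HasDerivAt (fun y => Real.log (r y)) ((1 - 2 * M / r x) / r x) x :=
    (hr.hasDerivAt x).log hpos.ne'
  have h2 : HasDerivAt (fun y => Real.log (r y - 2 * M)) ((1 - 2 * M / r x) / (r x - 2 * M)) x :=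
    ((hr.hasDerivAt x).sub_const (2 * M)).log hsub.ne'
  have h := (h1.const_mul (-2)).add (h2.const_mul (1 / 2))
  refine h.congr_deriv ?_
  have hr0 : r x ≠ 0 := hpos.ne'
  have hs0 : r x - 2 * M ≠ 0 := hsub.ne'
  field_simp
  ring

/-- The tortoise position of the shoulder `r = 8M/3`: `r(x_c − M/3 − 2M log(3/2)) = 8M/3`.
[folklore] -/
theorem radius_shoulder (hr : IsTortoiseRadius M r xc) :
    r (xc - (M / 3 + 2 * M * Real.log (3 / 2))) = 8 * M / 3 := by
  have hM := hr.mass_pos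
  have htc : tortoiseCoord M (8 * M / 3) = -(M / 3 + 2 * M * Real.log (3 / 2)) := by
    unfold tortoiseCoord
    have h1 : 8 * M / 3 - 2 * M = 2 / 3 * M := by ring
    rw [h1, Real.log_mul (by norm_num) hM.ne']
    have h2 : Real.log (2 / 3 : ℝ) = -Real.log (3 / 2) := by
      rw [← Real.log_inv]; norm_num
    rw [h2]
    ring
  have heq : tortoiseCoord M (r (xc - (M / 3 + 2 * M * Real.log (3 / 2))))
      = tortoiseCoord M (8 * M / 3) := by
    rw [hr.tortoiseCoord_eq, htc]
    ring
  exact injOn_tortoiseCoord hM.le (hr.two_mul_lt _) (by show 2 * M < 8 * M / 3; linarith) heq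

/-- **The lag integral from a deep edge to the shoulder is at least `log 3`**: for `x_e ≤ x_c − 9M`
and `x_w = x_c − M/3 − 2M log(3/2)` (the shoulder),
`log 3 ≤ ∫_{x_e}^{x_w} max(0, (8M − 3r)/(2r²)) dx`
(`= 2 log(3r_e/8M) + ½ log(2M/(3(r_e − 2M)))` with `r_e − 2M ≤ Me^{−4}`, and `3e⁴ ≥ 128`). [folklore] -/
theorem log_three_le_shoulderIntegral (hr : IsTortoiseRadius M r xc) {xe : ℝ}
    (hxe : xe ≤ xc - 9 * M) :
    Real.log 3 ≤ ∫ y in xe..(xc - (M / 3 + 2 * M * Real.log (3 / 2))),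
      max 0 ((8 * M - 3 * r y) / (2 * r y ^ 2)) := by
  have hM := hr.mass_pos
  set xw : ℝ := xc - (M / 3 + 2 * M * Real.log (3 / 2)) with hxw
  have hrw : r xw = 8 * M / 3 := radius_shoulder hr
  have hlog32 : Real.log (3 / 2) < 1 := by
    rw [Real.log_lt_iff_lt_exp (by norm_num)]
    have := Real.exp_one_gt_d9
    linarith
  have hlog32' : 0 ≤ Real.log (3 / 2) := Real.log_nonneg (by norm_num)
  have hew : xe ≤ xw := by
    simp only [hxw]
    nlinarith
  -- on `[xe, xw]` the rate is the smooth expression `(8M - 3r)/(2r²)`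
  have hle : ∀ y, y ≤ xw → r y ≤ 8 * M / 3 := fun y hy => by
    rw [← hrw]; exact hr.strictMono.monotone hy
  have hint : (∫ y in xe..xw, max 0 ((8 * M - 3 * r y) / (2 * r y ^ 2)))
      = ∫ y in xe..xw, (8 * M - 3 * r y) / (2 * r y ^ 2) := by
    refine intervalIntegral.integral_congr fun y hy => ?_
    rw [uIcc_of_le hew] at hy
    have hg0 : 0 ≤ (8 * M - 3 * r y) / (2 * r y ^ 2) :=
      div_nonneg (by linarith [hle y hy.2]) (by have := hr.pos y; positivity)
    exact max_eq_right hg0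
  -- fundamental theorem of calculus with the primitive `-2 log r + ½ log (r - 2M)`
  have hftc : (∫ y in xe..xw, (8 * M - 3 * r y) / (2 * r y ^ 2))
      = (-2 * Real.log (r xw) + 1 / 2 * Real.log (r xw - 2 * M))
        - (-2 * Real.log (r xe) + 1 / 2 * Real.log (r xe - 2 * M)) := by
    refine intervalIntegral.integral_eq_sub_of_hasDerivAt
      (fun y _ => hasDerivAt_shoulderPrimitive hr y) ?_
    refine Continuous.intervalIntegrable ?_ _ _
    have hrc := hr.continuous
    have hr0 : ∀ y, 2 * r y ^ 2 ≠ 0 := fun y => by have := hr.pos y; positivity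
    exact (continuous_const.sub (continuous_const.mul hrc)).div
      (continuous_const.mul (hrc.pow 2)) hr0
  rw [hint, hftc, hrw]
  -- bounds on `r xe`
  have hre2 : 2 * M < r xe := hr.two_mul_lt xe
  have hre_le : r xe - 2 * M ≤ M * Real.exp (-4) := by
    have h := hr.sub_two_mul_le xe
    have harg : (xe - xc) / (2 * M) ≤ -(9 / 2) := by
      rw [div_le_iff₀ (by positivity)]; linarith
    have hexp : Real.exp (1 / 2) * Real.exp ((xe - xc) / (2 * M)) ≤ Real.exp (-4) := by
      rw [← Real.exp_add]; exact Real.exp_le_exp.2 (by linarith)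
    calc r xe - 2 * M ≤ M * Real.exp (1 / 2) * Real.exp ((xe - xc) / (2 * M)) := h
      _ = M * (Real.exp (1 / 2) * Real.exp ((xe - xc) / (2 * M))) := by ring
      _ ≤ M * Real.exp (-4) := mul_le_mul_of_nonneg_left hexp hM.le
  -- `A = 3 r_e/(8M) ≥ 3/4`, `B = (2M/3)/(r_e − 2M) ≥ (2/3) e⁴`, and `A⁴ B ≥ 9`
  set A : ℝ := r xe / (8 * M / 3) with hA
  set B : ℝ := (8 * M / 3 - 2 * M) / (r xe - 2 * M) with hB
  have hApos : 0 < A := by simp only [hA]; exact div_pos (hr.pos xe) (by positivity)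
  have hsubpos : 0 < r xe - 2 * M := by linarith
  have hBpos : 0 < B := by
    simp only [hB]; exact div_pos (by linarith) hsubpos
  have hA34 : 3 / 4 ≤ A := by
    simp only [hA]
    rw [le_div_iff₀ (by positivity)]
    linarith
  have he4 : (54 : ℝ) ≤ Real.exp 4 := by
    have h := Real.exp_one_gt_d9
    have h2 : Real.exp 2 = Real.exp 1 * Real.exp 1 := by rw [← Real.exp_add]; norm_num
    have h4 : Real.exp 4 = Real.exp 2 * Real.exp 2 := by rw [← Real.exp_add]; norm_num
    have h2' : (7.389 : ℝ) ≤ Real.exp 2 := by rw [h2]; nlinarith [Real.exp_pos 1]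
    rw [h4]; nlinarith
  have hB' : 36 ≤ B := by
    -- `B = (2M/3)/(r_e - 2M) ≥ (2M/3)/(M e^{-4}) = (2/3) e⁴ ≥ 36`
    simp only [hB]
    rw [le_div_iff₀ hsubpos]
    have hexp4 : Real.exp (-4) * Real.exp 4 = 1 := by rw [← Real.exp_add]; norm_num
    have hpos4 : 0 < Real.exp (-4) := Real.exp_pos _
    nlinarith [mul_le_mul_of_nonneg_left hre_le (by norm_num : (0 : ℝ) ≤ 36),
      mul_le_mul_of_nonneg_left he4 (mul_nonneg hM.le hpos4.le)]
  have hAB : 9 ≤ A ^ 4 * B := by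
    have hA4 : (3 / 4 : ℝ) ^ 4 ≤ A ^ 4 := pow_le_pow_left₀ (by norm_num) hA34 4
    nlinarith [mul_le_mul hA4 hB' (by norm_num) (by positivity)]
  -- take logarithms
  have hlogAB : Real.log 9 ≤ Real.log (A ^ 4 * B) := Real.log_le_log (by norm_num) hAB
  have hlog9 : Real.log 9 = 2 * Real.log 3 := by
    rw [show (9 : ℝ) = 3 ^ 2 by norm_num, Real.log_pow]; norm_num
  have hlogA : Real.log A = Real.log (r xe) - Real.log (8 * M / 3) := by
    simp only [hA]; exact Real.log_div (hr.pos xe).ne' (by positivity)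
  have hlogB : Real.log B = Real.log (8 * M / 3 - 2 * M) - Real.log (r xe - 2 * M) := by
    simp only [hB]; exact Real.log_div (by linarith : (8 * M / 3 - 2 * M) ≠ 0) hsubpos.ne'
  have hA4 : Real.log (A ^ 4 * B) = 4 * Real.log A + Real.log B := by
    rw [Real.log_mul (by positivity) hBpos.ne', Real.log_pow]; norm_num
  have hfinal : 2 * Real.log 3 ≤ 4 * (Real.log (r xe) - Real.log (8 * M / 3))
      + (Real.log (8 * M / 3 - 2 * M) - Real.log (r xe - 2 * M)) := by
    rw [← hlog9, ← hlogA, ← hlogB, ← hA4]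
    exact hlogAB
  linarith

/-! ### The near half of `WindowedShellChannels` from the shoulder -/

/-- **Stub `stub_nearShoulder` — the near (horizon-side) half of `WindowedShellChannels` for shells of
half-width `ρ ≥ 9M`, with the positive aperture `a = M/3 + 2M log(3/2)` (the shoulder `r = 8M/3` of
the barrier) and constant `1/2`, uniformly in `s ≤ 2`, `ℓ ≥ s`.** For `M > 0`, `ρ ≥ 9M`, a tortoise
radius function `r` centred at `x_c`, `s ≤ 2`, `s ≤ ℓ`, and a global `C²` Regge–Wheeler solution `ψ`
whose Cauchy data are supported in `(−∞, x_c − ρ)`: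
`(1/2) · totalEnergy ≤ channelEnergy (aperture a, t → +∞) + channelEnergy (aperture a, t → −∞)`.
(Variable-rate windowed channel inequality with the shoulder rate; `∫ k ≥ log 3` gives `θ ≤ 1/3` and
`(1 − 2θ)/(1 − θ) ≥ 1/2`.) [folklore in method; new] -/
theorem stub_nearShoulder : ∀ M : ℝ, 0 < M → ∀ ρ : ℝ, 9 * M ≤ ρ → ∀ (r : ℝ → ℝ) (xc : ℝ), IsTortoiseRadius M r xc → ∀ (s ℓ : ℕ), s ≤ 2 → s ≤ ℓ → ∀ ψ : ℝ → ℝ → ℝ, IsRWSolution M s ℓ r ψ → CauchyDataSupportedOn ψ (Set.Iio (xc - ρ)) → ENNReal.ofReal (1 / 2) * totalEnergy (linePotential M s ℓ r) ψ 0 ≤ channelEnergy (linePotential M s ℓ r) xc (M / 3 + 2 * M * Real.log (3 / 2)) ψ atTop + channelEnergy (linePotential M s ℓ r) xc (M / 3 + 2 * M * Real.log (3 / 2)) ψ atBot := by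
  intro M hM ρ hρ r xc hr s ℓ _ hsℓ ψ hψ hsupp
  set V : ℝ → ℝ := linePotential M s ℓ r with hV
  set a : ℝ := M / 3 + 2 * M * Real.log (3 / 2) with ha
  set xw : ℝ := xc - a with hxw
  set k : ℝ → ℝ := fun x => max 0 ((8 * M - 3 * r x) / (2 * r x ^ 2)) with hk
  have hVC : ContDiff ℝ 1 V := RW.contDiff_one_linePotential hr s ℓ
  have hV0 : ∀ x, 0 ≤ V x := fun x => linePotential_nonneg hM.le hsℓ hr.two_mul_lt x
  have hkc : Continuous k := continuous_shoulderRate hr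
  have hk0 : ∀ x, 0 ≤ k x := fun x => le_max_left _ _
  have hka : Antitone k := antitone_shoulderRate hr
  have hrw : r xw = 8 * M / 3 := radius_shoulder hr
  have hmono : ∀ x, x ≤ xw → 2 * k x * V x ≤ deriv V x := fun x hx =>
    shoulderRate_mono hr s ℓ (by rw [← hrw]; exact hr.strictMono.monotone hx)
  have hlog32 : Real.log (3 / 2) < 1 := by
    rw [Real.log_lt_iff_lt_exp (by norm_num)]
    have := Real.exp_one_gt_d9
    linarith
  have hlog32' : 0 ≤ Real.log (3 / 2) := Real.log_nonneg (by norm_num)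
  have hapos : 0 < a := by simp only [ha]; positivity
  have ha9 : a < 9 * M := by simp only [ha]; nlinarith
  -- lag `h = ρ - a > 0`, edge `xw - h = xc - ρ`
  have hh : 0 < ρ - a := by linarith
  have hedge : xw - (ρ - a) = xc - ρ := by simp only [hxw]; ring
  have hint : Real.log 3 ≤ ∫ y in (xw - (ρ - a))..xw, k y := by
    rw [hedge]
    exact log_three_le_shoulderIntegral hr (by linarith)
  have hlog3 : 0 < Real.log 3 := Real.log_pos (by norm_num)
  have hpos : 0 < ∫ y in (xw - (ρ - a))..xw, k y := lt_of_lt_of_le hlog3 hint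
  have hsol : ∀ t x, iteratedDeriv 2 (fun τ => ψ τ x) t - iteratedDeriv 2 (ψ t) x + V x * ψ t x = 0 :=
    fun t x => hψ.2 (t, x)
  have hsupp' : ∀ x, xw - (ρ - a) ≤ x → ψ 0 x = 0 ∧ deriv (fun τ => ψ τ x) 0 = 0 := by
    intro x hx
    refine hsupp x ?_
    simp only [mem_Iio, not_lt]
    linarith [hedge.symm.le]
  have key := wave1D_nearWindowedChannel_variable hVC hV0 hkc hk0 hka hh hpos hmono hψ.1 hsol hsupp'
  -- the constant: `θ ≤ 1/3` gives `(1 - 2θ)/(1 - θ) ≥ 1/2`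
  set θ : ℝ := Real.exp (-(∫ y in (xw - (ρ - a))..xw, k y)) with hθ
  have hθle : θ ≤ 1 / 3 := by
    rw [hθ, ← Real.exp_log (by norm_num : (0 : ℝ) < 1 / 3)]
    apply Real.exp_le_exp.2
    have : Real.log (1 / 3 : ℝ) = -Real.log 3 := by
      rw [one_div, Real.log_inv]
    rw [this]
    linarith
  have hθpos : 0 < θ := Real.exp_pos _
  have hconst : ENNReal.ofReal (1 / 2) ≤ ENNReal.ofReal ((1 - 2 * θ) / (1 - θ)) := by
    apply ENNReal.ofReal_le_ofReal
    rw [le_div_iff₀ (by linarith)]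
    linarith
  -- the near windows lie inside the exterior regions of aperture `a`
  have hsub : ∀ t : ℝ, Iio (xw - |t|) ⊆ {x : ℝ | a + |t| < |x - xc|} := by
    intro t x hx
    rw [mem_Iio, hxw] at hx
    rw [mem_setOf_eq]
    have h1 : xc - x ≤ |x - xc| := by
      rw [abs_sub_comm]
      exact le_abs_self _
    linarith
  have htop : liminf (fun t => ∫⁻ x in Iio (xw - t), ENNReal.ofReal
        (deriv (fun τ => ψ τ x) t ^ 2 + deriv (ψ t) x ^ 2 + V x * ψ t x ^ 2)) atTop
      ≤ channelEnergy V xc a ψ atTop := by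
    unfold channelEnergy exteriorEnergy energyDensity
    refine liminf_le_liminf ?_
    filter_upwards [eventually_ge_atTop 0] with t ht
    have hs' : Iio (xw - t) ⊆ {x : ℝ | a + |t| < |x - xc|} := by
      have : xw - t = xw - |t| := by rw [abs_of_nonneg ht]
      rw [this]
      exact hsub t
    exact lintegral_mono_set hs'
  have hbot : liminf (fun t => ∫⁻ x in Iio (xw + t), ENNReal.ofReal
        (deriv (fun τ => ψ τ x) t ^ 2 + deriv (ψ t) x ^ 2 + V x * ψ t x ^ 2)) atBot
      ≤ channelEnergy V xc a ψ atBot := by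
    unfold channelEnergy exteriorEnergy energyDensity
    refine liminf_le_liminf ?_
    filter_upwards [eventually_le_atBot 0] with t ht
    have hs' : Iio (xw + t) ⊆ {x : ℝ | a + |t| < |x - xc|} := by
      have : xw + t = xw - |t| := by rw [abs_of_nonpos ht]; ring
      rw [this]
      exact hsub t
    exact lintegral_mono_set hs'
  have htot : totalEnergy V ψ 0 = ∫⁻ x, ENNReal.ofReal
      (deriv (fun τ => ψ τ x) 0 ^ 2 + deriv (ψ 0) x ^ 2 + V x * ψ 0 x ^ 2) := rfl
  calc ENNReal.ofReal (1 / 2) * totalEnergy V ψ 0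
      ≤ ENNReal.ofReal ((1 - 2 * θ) / (1 - θ)) * totalEnergy V ψ 0 := by gcongr
    _ ≤ _ := by rw [htot]; exact key
    _ ≤ channelEnergy V xc a ψ atTop + channelEnergy V xc a ψ atBot := add_le_add htop hbot

end WindowedShellChannelsNear

end

end Summit.FinalStateConjecture.FinalStateConjecture.Theorems
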